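import Summits.AtomisticToContinuum.Crystallization.Theorems.PalmUnimodularRigidityLayeredLawsSelectHcpMinimiserEnclosureAssembly
import Summits.AtomisticToContinuum.Crystallization.Theorems.PalmUnimodularRigidityLayeredLawsSelectHcpMinimiserEnclosureKernelC
import Summits.AtomisticToContinuum.Crystallization.Theorems.PalmUnimodularRigidityLayeredLawsSelectHcpMinimiserEnclosureKernelD

/-!
# Minimiser enclosure of the relaxed hcp cell (registered stub `tube_minimiserEnclosure`)
(line `mtp-prestress-split-ergodic-frame`, crux `LayeredLawsSelectHcp`, stmt-AtomisticToContinuum-9226)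

The global minimiser `(a₀, h₀)` of the hcp energy function `hcpE` in the window `[189/200, 199/200] × [77/100,
163/200]` satisfies `|a₀ − 0.97129| ≤ 10⁻⁴` and `|h₀ − 0.79294| ≤ 10⁻⁴`: the assembly
`tube_minimiserEnclosure_of_kernels` (`…MinimiserEnclosureAssembly`: Fermat-sign bracket of the layer ratio,
mean-value brackets of `S₃, S₆` from the right end, six dilation/height cells) fed with the two kernel-evaluated
floor sums `tube_minimiserEnclosureKernelC` (`S₃` at `0.81646`, cube `K = 30`) and `tube_minimiserEnclosureKernelD`
(`D₃` at `0.81629`, cube `K = 38`).  [folklore]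
-/

namespace Summit.AtomisticToContinuum.Crystallization.Theorems.PalmUnimodularRigidity.LayeredLawsSelectHcp

/-- **Registered stub `tube_minimiserEnclosure` of stmt-AtomisticToContinuum-9226 (line
`mtp-prestress-split-ergodic-frame`, crux `LayeredLawsSelectHcp`): the minimiser enclosure of the relaxed
Lennard-Jones hcp cell** — every global minimiser `(a₀, h₀)` of `hcpE` in the window has `|a₀ − 0.97129| ≤ 10⁻⁴` and
`|h₀ − 0.79294| ≤ 10⁻⁴` (assembly modulo kernels + kernels C and D). [folklore] -/
theorem tube_minimiserEnclosure : ∀ a₀ h₀ : ℝ, 189 / 200 ≤ a₀ → a₀ ≤ 199 / 200 → 77 / 100 ≤ h₀ → h₀ ≤ 163 / 200 → (∀ a h : ℝ, 0 < a → 0 < h → hcpE a₀ h₀ ≤ hcpE a h) → |a₀ - 97129 / 100000| ≤ 1 / 10000 ∧ |h₀ - 79294 / 100000| ≤ 1 / 10000 :=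
  tube_minimiserEnclosure_of_kernels tube_minimiserEnclosureKernelC tube_minimiserEnclosureKernelD

end Summit.AtomisticToContinuum.Crystallization.Theorems.PalmUnimodularRigidity.LayeredLawsSelectHcp
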